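import Summits.Ventures.PercRepro.C025ProfileLevelProfile

/-!
# EVERY ROW `(q, u)` OF (Π), `q < u < r`, ON «A FAT FLAT PLUS FREE POINTS» — C-025 AT EVERY `(p, q)` WITH `q ≤ s + m − r` (night-3 g24)

`proofs/NIGHT3-G24-ONEFLAT.md` §7.  The majorization of `OneFlat.majorize` (level `r − 1`) works at every level `u ≤ r`: in the
regime `r + q ≤ s + m` every price at level `u` is `≤ π_u := C(r+q,u)/C(r+q,q)`, the base `Σ_c C(s,c)·D_c = C(r+q,q)·C(s+m,u) −
C(r+q,u)·C(s+m,q) ≥ 0`, and `f(c) := C(m,u−c)/C(m,q−c)` is increasing in `c` (log-concavity), so the negative `D_c` precede the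
positive ones.  With `level_profile_mono`, EVERY row `(q, u)`, `q < u < r`, holds on every finite `M` with `gr M = gr M₁ ⊔ E₂` and
`ρ_M(X) = min(r, ρ_{M₁}(X ∩ E₁) + |X ∩ E₂|)` when `r + q ≤ s + m`; through `GirthRows.rls_of_profileIneq_rows` this is
**C-025 at every `(p, q)` with `p ≤ r` and `q ≤ s + m − r`** on `T_r(M₁ ⊕ U_{m,m})`, `M₁` arbitrary.
* `choose_mul_choose_le_of_le`, `ratio_mono`, `lt_of_Du_neg_of_Du_pos`, `majorize_rows` — the arithmetic at level `u`;
* `price_le_div_rows`, `card_levelSet_fiber_ge_rows`, `card_levelSet_ge_rows`, `profileIneq_rows_of_split` — the matroid side;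
* **`profileIneq_rows_of_split_matroid`**, **`rls_of_split_matroid_all`** — the theorems.
No `def`, no `instance`, no notation.  Axioms: standard.
-/

open scoped Matroid

namespace PercRepro

open Finset ThmH

namespace OneFlat

/-- Log-concavity of a binomial row: `C(m,b+1)·C(m,a) ≤ C(m,b)·C(m,a+1)` for `a ≤ b`. -/
theorem choose_mul_choose_le_of_le {m a b : ℕ} (hab : a ≤ b) :
    m.choose (b + 1) * m.choose a ≤ m.choose b * m.choose (a + 1) := by
  rcases Nat.lt_or_ge m (b + 1) with hmb | hmb
  · rw [Nat.choose_eq_zero_of_lt hmb, zero_mul]; exact Nat.zero_le _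
  · have h1 := Nat.choose_succ_right_eq m b
    have h2 := Nat.choose_succ_right_eq m a
    apply Nat.le_of_mul_le_mul_right (c := (a + 1) * (b + 1)) _ (by positivity)
    calc m.choose (b + 1) * m.choose a * ((a + 1) * (b + 1))
        = (m.choose (b + 1) * (b + 1)) * (m.choose a * (a + 1)) := by ring
      _ = (m.choose b * (m - b)) * (m.choose a * (a + 1)) := by rw [h1]
      _ ≤ (m.choose b * (m - a)) * (m.choose a * (b + 1)) := by
          have hx : (m - b) * (a + 1) ≤ (m - a) * (b + 1) := by
            have h3 : m - b ≤ m - a := Nat.sub_le_sub_left hab m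
            nlinarith [h3, Nat.sub_add_cancel hmb, Nat.sub_add_cancel (by omega : a ≤ m)]
          calc (m.choose b * (m - b)) * (m.choose a * (a + 1))
              = (m.choose b * m.choose a) * ((m - b) * (a + 1)) := by ring
            _ ≤ (m.choose b * m.choose a) * ((m - a) * (b + 1)) := Nat.mul_le_mul_left _ hx
            _ = (m.choose b * (m - a)) * (m.choose a * (b + 1)) := by ring
      _ = m.choose b * (m.choose (a + 1) * (a + 1)) * (b + 1) := by rw [h2]; ring
      _ = m.choose b * m.choose (a + 1) * ((a + 1) * (b + 1)) := by ring

/-- The ratio `C(m, u−c)/C(m, q−c)` is non-decreasing in `c` (cross-multiplied), for `c ≤ c' ≤ q ≤ u`. -/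
theorem ratio_mono {m u q c c' : ℕ} (hqu : q ≤ u) (hcc' : c ≤ c') (hc'q : c' ≤ q) :
    m.choose (u - c) * m.choose (q - c') ≤ m.choose (u - c') * m.choose (q - c) := by
  induction c', hcc' using Nat.le_induction with
  | base => exact le_rfl
  | succ c' hcc' ih =>
    have ih' := ih (by omega)
    have hstep : m.choose (u - c') * m.choose (q - (c' + 1)) ≤ m.choose (u - (c' + 1)) * m.choose (q - c') := by
      have h := choose_mul_choose_le_of_le (m := m) (a := q - (c' + 1)) (b := u - (c' + 1)) (by omega)
      rw [show u - (c' + 1) + 1 = u - c' by omega, show q - (c' + 1) + 1 = q - c' by omega] at h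
      exact h
    rcases Nat.eq_zero_or_pos (m.choose (q - c')) with h0 | hpos
    · -- `C(m, q−c') = 0`: then `q − c' > m`, so `q − c > m` and both sides vanish
      have hq' : m < q - c' := Nat.choose_eq_zero_iff.1 h0
      have hqc : m.choose (q - c) = 0 := Nat.choose_eq_zero_of_lt (by omega)
      rw [hqc, mul_zero]
      rcases Nat.lt_or_ge m (q - (c' + 1)) with hlt | hge
      · rw [Nat.choose_eq_zero_of_lt hlt, mul_zero]
      · -- `q − c' − 1 ≤ m < q − c'`, so `q − c' = m + 1` and `u − c ≥ q − c > m`: `C(m, u−c) = 0`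
        have : m < u - c := by omega
        rw [Nat.choose_eq_zero_of_lt this, zero_mul]
    · apply Nat.le_of_mul_le_mul_right (c := m.choose (q - c')) _ hpos
      calc m.choose (u - c) * m.choose (q - (c' + 1)) * m.choose (q - c')
          = (m.choose (u - c) * m.choose (q - c')) * m.choose (q - (c' + 1)) := by ring
        _ ≤ (m.choose (u - c') * m.choose (q - c)) * m.choose (q - (c' + 1)) := Nat.mul_le_mul_right _ ih'
        _ = (m.choose (u - c') * m.choose (q - (c' + 1))) * m.choose (q - c) := by ring
        _ ≤ (m.choose (u - (c' + 1)) * m.choose (q - c')) * m.choose (q - c) := Nat.mul_le_mul_right _ hstep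
        _ = m.choose (u - (c' + 1)) * m.choose (q - c) * m.choose (q - c') := by ring

/-- The ordering at level `u`: a negative `D c'` precedes a positive `D c`, where
`D c = C(r+q,q)·C(m,u−c) − C(r+q,u)·C(m,q−c)·[c ≤ q]`. -/
theorem lt_of_Du_neg_of_Du_pos {m r u q c c' : ℕ} (hqu : q ≤ u)
    (hneg : ((r + q).choose q : ℚ) * (m.choose (u - c') : ℚ)
      - ((r + q).choose u : ℚ) * (if c' ≤ q then (m.choose (q - c') : ℚ) else 0) < 0)
    (hpos : 0 < ((r + q).choose q : ℚ) * (m.choose (u - c) : ℚ)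
      - ((r + q).choose u : ℚ) * (if c ≤ q then (m.choose (q - c) : ℚ) else 0)) :
    c' < c := by
  have hS' : (0 : ℚ) ≤ ((r + q).choose q : ℚ) * (m.choose (u - c') : ℚ) := by positivity
  have hc' : c' ≤ q := by
    by_contra hcon
    rw [if_neg hcon] at hneg
    linarith
  rw [if_pos hc'] at hneg
  by_contra hcc
  push Not at hcc
  have hc : c ≤ q := le_trans hcc hc'
  rw [if_pos hc] at hpos
  have hA' : (0 : ℚ) < (m.choose (q - c') : ℚ) := by
    rcases (Nat.cast_nonneg (α := ℚ) (m.choose (q - c'))).lt_or_eq with h | h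
    · exact h
    · rw [← h] at hneg; linarith
  have hA : (0 : ℚ) < (m.choose (q - c) : ℚ) := by
    rcases (Nat.cast_nonneg (α := ℚ) (m.choose (q - c))).lt_or_eq with h | h
    · exact h
    · exfalso
      have hq0 : m.choose (q - c) = 0 := by exact_mod_cast h.symm
      have hlt : m < q - c := Nat.choose_eq_zero_iff.1 hq0
      have hu0 : m.choose (u - c) = 0 := Nat.choose_eq_zero_of_lt (by omega)
      rw [hu0, hq0] at hpos
      simp at hpos
  -- the monotonicity of the ratio, cross-multiplied
  have hmono := ratio_mono (m := m) (u := u) (q := q) hqu hcc hc'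
  have hmono' : (m.choose (u - c) : ℚ) * (m.choose (q - c') : ℚ) ≤
      (m.choose (u - c') : ℚ) * (m.choose (q - c) : ℚ) := by exact_mod_cast hmono
  have hCq : (0 : ℚ) ≤ ((r + q).choose q : ℚ) := by positivity
  have hCu : (0 : ℚ) ≤ ((r + q).choose u : ℚ) := by positivity
  nlinarith [mul_lt_mul_of_pos_right hpos hA', mul_lt_mul_of_pos_right hneg hA,
    mul_le_mul_of_nonneg_left hmono' hCq]

/-- **THE MAJORIZATION THEOREM AT EVERY LEVEL `u`**, `q ≤ u ≤ r`, `r + q ≤ s + m`, profile `W` monotone and vanishing above `s`: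
`C(r+q,u) · Σ_{c ≤ q} W c · C(m, q−c) ≤ C(r+q,q) · Σ_{c ≤ u} W c · C(m, u−c)`. -/
theorem majorize_rows (W : ℕ → ℕ) (s m r q u : ℕ) (hqu : q ≤ u) (hur : u ≤ r) (hreg : r + q ≤ s + m)
    (hW : ∀ c, s < c → W c = 0)
    (hmono : ∀ c' c, c' ≤ c → c ≤ s → W c' * s.choose c ≤ W c * s.choose c') :
    ((r + q).choose u : ℚ) * ∑ c ∈ range (q + 1), (W c : ℚ) * (m.choose (q - c) : ℚ) ≤
      ((r + q).choose q : ℚ) * ∑ c ∈ range (u + 1), (W c : ℚ) * (m.choose (u - c) : ℚ) := by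
  set D : ℕ → ℚ := fun c =>
    ((r + q).choose q : ℚ) * (m.choose (u - c) : ℚ)
      - ((r + q).choose u : ℚ) * (if c ≤ q then (m.choose (q - c) : ℚ) else 0) with hD
  have hfilter : (range (u + 1)).filter (fun c => c ≤ q) = range (q + 1) := by
    ext c; simp only [mem_filter, mem_range]; omega
  have hmem : ∀ (V : ℕ → ℚ), ∑ c ∈ range (q + 1), V c * (m.choose (q - c) : ℚ) =
      ∑ c ∈ range (u + 1), V c * (if c ≤ q then (m.choose (q - c) : ℚ) else 0) := by
    intro V
    rw [← hfilter, sum_filter]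
    apply sum_congr rfl
    intro c _
    split_ifs <;> simp
  have hgoal : ((r + q).choose q : ℚ) * ∑ c ∈ range (u + 1), (W c : ℚ) * (m.choose (u - c) : ℚ)
      - ((r + q).choose u : ℚ) * ∑ c ∈ range (q + 1), (W c : ℚ) * (m.choose (q - c) : ℚ)
      = ∑ c ∈ range (u + 1), (W c : ℚ) * D c := by
    rw [hmem, mul_sum, mul_sum, ← sum_sub_distrib]
    apply sum_congr rfl
    intro c _
    simp only [hD]
    ring
  suffices hsum : 0 ≤ ∑ c ∈ range (u + 1), (W c : ℚ) * D c by linarith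
  -- the base
  have hbase : 0 ≤ ∑ c ∈ range (u + 1), (s.choose c : ℚ) * D c := by
    have h1 : ∑ c ∈ range (u + 1), (s.choose c : ℚ) * D c
        = ((r + q).choose q : ℚ) * ∑ c ∈ range (u + 1), (s.choose c : ℚ) * (m.choose (u - c) : ℚ)
          - ((r + q).choose u : ℚ) * ∑ c ∈ range (q + 1), (s.choose c : ℚ) * (m.choose (q - c) : ℚ) := by
      rw [hmem, mul_sum, mul_sum, ← sum_sub_distrib]
      apply sum_congr rfl
      intro c _
      simp only [hD]
      ring
    rw [h1, sum_choose_mul_choose_range s m u, sum_choose_mul_choose_range s m q]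
    have hm := PriceMono.choose_div_choose_mono (p := r) (p' := s + m - q) (q := q) (u := u) hqu hur (by omega)
    rw [show s + m - q + q = s + m by omega] at hm
    have hpos1 : (0 : ℚ) < ((r + q).choose q : ℚ) := by exact_mod_cast Nat.choose_pos (by omega)
    have hpos2 : (0 : ℚ) < ((s + m).choose q : ℚ) := by exact_mod_cast Nat.choose_pos (by omega)
    rw [div_le_div_iff₀ hpos1 hpos2] at hm
    linarith
  -- the majorization
  by_cases hneg : ∃ c ∈ range (u + 1), D c < 0
  · obtain ⟨c₁, hc₁r, hc₁⟩ := hneg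
    set N : Finset ℕ := (range (u + 1)).filter (fun c => D c < 0) with hN
    have hNne : N.Nonempty := ⟨c₁, by simp only [hN, mem_filter]; exact ⟨hc₁r, hc₁⟩⟩
    set cN := N.max' hNne with hcN
    have hcN_mem : cN ∈ N := N.max'_mem hNne
    have hcN_neg : D cN < 0 := by
      have := hcN_mem; simp only [hN, mem_filter] at this; exact this.2
    have hle_cN : ∀ c ∈ range (u + 1), D c < 0 → c ≤ cN := by
      intro c hc hDc
      exact N.le_max' c (by simp only [hN, mem_filter]; exact ⟨hc, hDc⟩)
    set c₀ := min cN s with hc₀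
    have hc₀s : c₀ ≤ s := min_le_right _ _
    have hc₀pos : (0 : ℚ) < (s.choose c₀ : ℚ) := by exact_mod_cast Nat.choose_pos hc₀s
    have hpt : ∀ c ∈ range (u + 1), (W c₀ : ℚ) * (s.choose c : ℚ) * D c ≤ (W c : ℚ) * (s.choose c₀ : ℚ) * D c := by
      intro c hc
      rcases lt_trichotomy (D c) 0 with hDc | hDc | hDc
      · have hccN : c ≤ cN := hle_cN c hc hDc
        rcases Nat.lt_or_ge s c with hsc | hcs
        · rw [hW c hsc, Nat.choose_eq_zero_of_lt hsc]; simp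
        · have hcc₀ : c ≤ c₀ := le_min hccN hcs
          have hm := hmono c c₀ hcc₀ hc₀s
          have hm' : (W c : ℚ) * (s.choose c₀ : ℚ) ≤ (W c₀ : ℚ) * (s.choose c : ℚ) := by exact_mod_cast hm
          nlinarith [hm', hDc]
      · rw [hDc]; simp
      · have hcNc : cN < c := lt_of_Du_neg_of_Du_pos hqu hcN_neg hDc
        rcases Nat.lt_or_ge s c with hsc | hcs
        · rw [hW c hsc, Nat.choose_eq_zero_of_lt hsc]; simp
        · have hc₀c : c₀ ≤ c := le_trans (min_le_left _ _) hcNc.le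
          have hm := hmono c₀ c hc₀c hcs
          have hm' : (W c₀ : ℚ) * (s.choose c : ℚ) ≤ (W c : ℚ) * (s.choose c₀ : ℚ) := by exact_mod_cast hm
          nlinarith [hm', hDc]
    have hsumle := sum_le_sum hpt
    have hL : ∑ c ∈ range (u + 1), (W c₀ : ℚ) * (s.choose c : ℚ) * D c
        = (W c₀ : ℚ) * ∑ c ∈ range (u + 1), (s.choose c : ℚ) * D c := by
      rw [mul_sum]; apply sum_congr rfl; intro c _; ring
    have hR : ∑ c ∈ range (u + 1), (W c : ℚ) * (s.choose c₀ : ℚ) * D c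
        = (s.choose c₀ : ℚ) * ∑ c ∈ range (u + 1), (W c : ℚ) * D c := by
      rw [mul_sum]; apply sum_congr rfl; intro c _; ring
    rw [hL, hR] at hsumle
    have hW₀ : (0 : ℚ) ≤ (W c₀ : ℚ) := by positivity
    have hLnn : (0 : ℚ) ≤ (W c₀ : ℚ) * ∑ c ∈ range (u + 1), (s.choose c : ℚ) * D c := mul_nonneg hW₀ hbase
    exact (mul_nonneg_iff_of_pos_left hc₀pos).1 (le_trans hLnn hsumle)
  · push Not at hneg
    apply sum_nonneg
    intro c hc
    exact mul_nonneg (by positivity) (hneg c hc)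

variable {α : Type} [DecidableEq α]

/-- When every complement has rank `≤ r`, the price of a rank-`q` set at a level `u ≤ r` is at most `C(r+q,u)/C(r+q,q)`. -/
theorem price_le_div_rows {M : Matroid α} [M.Finite] {r q u : ℕ} (hqu : q ≤ u)
    (hle : ∀ X : Finset α, X ⊆ gr M → M.eRk (X : Set α) ≤ (r : ℕ∞)) (B : Finset α) :
    Profile.price M q u B ≤ ((r + q).choose u : ℚ) / ((r + q).choose q : ℚ) := by
  have hfin : M.eRk ((gr M \ B : Finset α) : Set α) ≠ ⊤ := by
    have := M.eRk_le_eRank ((gr M \ B : Finset α) : Set α)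
    exact ne_top_of_le_ne_top (M.eRank_ne_top_iff.2 inferInstance) this
  obtain ⟨p, hp⟩ : ∃ p : ℕ, M.eRk ((gr M \ B : Finset α) : Set α) = (p : ℕ∞) :=
    ⟨_, (ENat.coe_toNat hfin).symm⟩
  have hpr : p ≤ r := by
    have := hle (gr M \ B) sdiff_subset
    rw [hp] at this
    exact_mod_cast this
  by_cases hup : u ≤ p
  · rw [PriceMono.price_eq_of_le hp hup]
    exact PriceMono.choose_div_choose_mono hqu hup hpr
  · have : Profile.price M q u B = 0 := by
      unfold Profile.price
      rw [hp, if_neg (by exact_mod_cast hup)]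
    rw [this]; positivity

section Split

variable (M : Matroid α) [M.Finite] (E₁ E₂ : Finset α) (ρ₁ : Finset α → ℕ) (r : ℕ)

/-- (Level-`c` sets of `E₁`) × (`(u−c)`-subsets of `E₂`) inject by union into the fibre of the level `u < r`. -/
theorem card_levelSet_fiber_ge_rows (hE : gr M = E₁ ∪ E₂) (hdisj : Disjoint E₁ E₂)
    (hrk : ∀ X : Finset α, X ⊆ gr M →
      M.eRk (X : Set α) = ((min r (ρ₁ (X ∩ E₁) + (X ∩ E₂).card) : ℕ) : ℕ∞))
    (u : ℕ) (hu : u < r) (c : ℕ) (hc : c ≤ u) :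
    ((E₁.powerset).filter (fun Y => ρ₁ Y = c)).card * (E₂.card).choose (u - c) ≤
      ((Shadow.levelSet M u).filter (fun S => ρ₁ (S ∩ E₁) = c)).card := by
  have e1 : ∀ (Y Z : Finset α), Y ⊆ E₁ → Z ⊆ E₂ → (Y ∪ Z) ∩ E₁ = Y := by
    intro Y Z hY hZ
    rw [union_inter_distrib_right, inter_eq_left.2 hY,
      disjoint_iff_inter_eq_empty.1 (disjoint_of_subset_left hZ hdisj.symm), union_empty]
  have e2 : ∀ (Y Z : Finset α), Y ⊆ E₁ → Z ⊆ E₂ → (Y ∪ Z) ∩ E₂ = Z := by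
    intro Y Z hY hZ
    rw [union_inter_distrib_right, inter_eq_left.2 hZ,
      disjoint_iff_inter_eq_empty.1 (disjoint_of_subset_left hY hdisj), empty_union]
  rw [← card_powersetCard, ← card_product]
  apply card_le_card_of_injOn (fun YZ : Finset α × Finset α => YZ.1 ∪ YZ.2)
  · rintro ⟨Y, Z⟩ hYZ
    simp only [coe_product, Set.mem_prod, coe_filter, mem_powerset, Set.mem_setOf_eq, mem_coe,
      mem_powersetCard] at hYZ
    obtain ⟨⟨hY, hYc⟩, hZ, hZc⟩ := hYZ
    have hsub : Y ∪ Z ⊆ gr M := by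
      rw [hE]; exact union_subset_union hY hZ
    simp only [coe_filter, Set.mem_setOf_eq, Profile.mem_levelSet]
    refine ⟨⟨hsub, ?_⟩, by rw [e1 Y Z hY hZ]; exact hYc⟩
    rw [hrk (Y ∪ Z) hsub, e1 Y Z hY hZ, e2 Y Z hY hZ, hYc, hZc]
    congr 1
    omega
  · rintro ⟨Y, Z⟩ hYZ ⟨Y', Z'⟩ hYZ' h
    simp only [coe_product, Set.mem_prod, coe_filter, mem_powerset, Set.mem_setOf_eq, mem_coe,
      mem_powersetCard] at hYZ hYZ'
    simp only at h
    have hY : Y = Y' := by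
      rw [← e1 Y Z hYZ.1.1 hYZ.2.1, ← e1 Y' Z' hYZ'.1.1 hYZ'.2.1, h]
    have hZ : Z = Z' := by
      rw [← e2 Y Z hYZ.1.1 hYZ.2.1, ← e2 Y' Z' hYZ'.1.1 hYZ'.2.1, h]
    rw [hY, hZ]

/-- The level `u < r` has at least `Σ_{c ≤ u} W c · C(m, u−c)` sets. -/
theorem card_levelSet_ge_rows (hE : gr M = E₁ ∪ E₂) (hdisj : Disjoint E₁ E₂)
    (hrk : ∀ X : Finset α, X ⊆ gr M →
      M.eRk (X : Set α) = ((min r (ρ₁ (X ∩ E₁) + (X ∩ E₂).card) : ℕ) : ℕ∞))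
    (u : ℕ) (hu : u < r) :
    ∑ c ∈ range (u + 1), ((E₁.powerset).filter (fun Y => ρ₁ Y = c)).card * (E₂.card).choose (u - c) ≤
      (Shadow.levelSet M u).card := by
  have hmaps : Set.MapsTo (fun S => ρ₁ (S ∩ E₁)) ↑(Shadow.levelSet M u) ↑(range (u + 1)) := by
    intro S hS
    simp only [mem_coe, Profile.mem_levelSet] at hS
    have hSr := hS.2
    rw [hrk S hS.1] at hSr
    have hSr' : min r (ρ₁ (S ∩ E₁) + (S ∩ E₂).card) = u := by exact_mod_cast hSr
    simp only [mem_coe, mem_range]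
    omega
  rw [card_eq_sum_card_fiberwise hmaps]
  apply sum_le_sum
  intro c hc
  exact card_levelSet_fiber_ge_rows M E₁ E₂ ρ₁ r hE hdisj hrk u hu c (by simpa [Nat.lt_succ_iff] using mem_range.1 hc)

/-- **EVERY ROW `(q, u)`, `q < u < r`, ON «A FAT FLAT PLUS FREE POINTS»** with a monotone profile, `r + q ≤ s + |E₂|`. -/
theorem profileIneq_rows_of_split (hE : gr M = E₁ ∪ E₂) (hdisj : Disjoint E₁ E₂) (s : ℕ)
    (hρ₁ : ∀ Y : Finset α, Y ⊆ E₁ → ρ₁ Y ≤ s)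
    (hrk : ∀ X : Finset α, X ⊆ gr M →
      M.eRk (X : Set α) = ((min r (ρ₁ (X ∩ E₁) + (X ∩ E₂).card) : ℕ) : ℕ∞))
    (hmono : ∀ c' c, c' ≤ c → c ≤ s →
      ((E₁.powerset).filter (fun Y => ρ₁ Y = c')).card * s.choose c ≤
        ((E₁.powerset).filter (fun Y => ρ₁ Y = c)).card * s.choose c')
    (q u : ℕ) (hqu : q < u) (hur : u < r) (hreg : r + q ≤ s + E₂.card) :
    Profile.ProfileIneq M q u := by
  unfold Profile.ProfileIneq
  have hle : ∀ X : Finset α, X ⊆ gr M → M.eRk (X : Set α) ≤ (r : ℕ∞) := by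
    intro X hX
    rw [hrk X hX]
    exact_mod_cast min_le_left _ _
  have hA : ∑ B ∈ Profile.Rq M q, Profile.price M q u B ≤
      ((Profile.Rq M q).card : ℚ) * (((r + q).choose u : ℚ) / ((r + q).choose q : ℚ)) := by
    rw [card_eq_sum_ones, Nat.cast_sum, sum_mul]
    apply sum_le_sum
    intro B _
    rw [Nat.cast_one, one_mul]
    exact price_le_div_rows hqu.le hle B
  have hB := card_Rq_le M E₁ E₂ ρ₁ r hE hrk q (by omega)
  have hC := card_levelSet_ge_rows M E₁ E₂ ρ₁ r hE hdisj hrk u hur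
  have hW : ∀ c, s < c → ((E₁.powerset).filter (fun Y => ρ₁ Y = c)).card = 0 := by
    intro c hc
    rw [card_eq_zero, filter_eq_empty_iff]
    intro Y hY hYc
    have := hρ₁ Y (mem_powerset.1 hY)
    omega
  have hD := majorize_rows (fun c => ((E₁.powerset).filter (fun Y => ρ₁ Y = c)).card) s E₂.card r q u
    hqu.le hur.le hreg hW hmono
  have hpos : (0 : ℚ) < ((r + q).choose q : ℚ) := by exact_mod_cast Nat.choose_pos (by omega)
  have hB' : ((Profile.Rq M q).card : ℚ) ≤
      ∑ c ∈ range (q + 1), (((E₁.powerset).filter (fun Y => ρ₁ Y = c)).card : ℚ) * ((E₂.card).choose (q - c) : ℚ) := by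
    exact_mod_cast hB
  have hC' : ∑ c ∈ range (u + 1), (((E₁.powerset).filter (fun Y => ρ₁ Y = c)).card : ℚ) * ((E₂.card).choose (u - c) : ℚ) ≤
      ((Shadow.levelSet M u).card : ℚ) := by
    exact_mod_cast hC
  calc ∑ B ∈ Profile.Rq M q, Profile.price M q u B
      ≤ ((Profile.Rq M q).card : ℚ) * (((r + q).choose u : ℚ) / ((r + q).choose q : ℚ)) := hA
    _ ≤ (∑ c ∈ range (q + 1), (((E₁.powerset).filter (fun Y => ρ₁ Y = c)).card : ℚ) *
          ((E₂.card).choose (q - c) : ℚ)) * (((r + q).choose u : ℚ) / ((r + q).choose q : ℚ)) := by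
        apply mul_le_mul_of_nonneg_right hB' (by positivity)
    _ ≤ ∑ c ∈ range (u + 1), (((E₁.powerset).filter (fun Y => ρ₁ Y = c)).card : ℚ) *
          ((E₂.card).choose (u - c) : ℚ) := by
        rw [mul_div_assoc', div_le_iff₀ hpos]
        linarith [hD]
    _ ≤ ((Shadow.levelSet M u).card : ℚ) := hC'

end Split

section Matroid

variable (M : Matroid α) [M.Finite] (M₁ : Matroid α) [M₁.Finite] (E₂ : Finset α) (r : ℕ)

/-- **EVERY ROW `(q, u)`, `q < u < r`, OF (Π) ON `T_r(M₁ ⊕ U_{m,m})` FOR EVERY FINITE MATROID `M₁`**, `r + q ≤ s + m`. -/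
theorem profileIneq_rows_of_split_matroid (hE : gr M = gr M₁ ∪ E₂) (hdisj : Disjoint (gr M₁) E₂)
    {s : ℕ} (hs : M₁.eRank = (s : ℕ∞))
    (hrk : ∀ X : Finset α, X ⊆ gr M →
      M.eRk (X : Set α) = ((min r ((M₁.eRk ((X ∩ gr M₁ : Finset α) : Set α)).toNat + (X ∩ E₂).card) : ℕ) : ℕ∞))
    (q u : ℕ) (hqu : q < u) (hur : u < r) (hreg : r + q ≤ s + E₂.card) :
    Profile.ProfileIneq M q u := by
  have hfin : ∀ Y : Finset α, M₁.eRk (Y : Set α) ≠ ⊤ := by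
    intro Y
    exact ne_top_of_le_ne_top (M₁.eRank_ne_top_iff.2 inferInstance) (M₁.eRk_le_eRank _)
  have hlevel : ∀ c, ((gr M₁).powerset.filter (fun Y : Finset α => (M₁.eRk (Y : Set α)).toNat = c)).card =
      (Shadow.levelSet M₁ c).card := by
    intro c
    congr 1
    apply filter_congr
    intro Y _
    constructor
    · intro h
      rw [← h, ENat.coe_toNat (hfin Y)]
    · intro h
      rw [h, ENat.toNat_coe]
  apply profileIneq_rows_of_split M (gr M₁) E₂ (fun Y => (M₁.eRk (Y : Set α)).toNat) r hE hdisj s _ hrk _ q u hqu hur hreg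
  · intro Y _
    have h := M₁.eRk_le_eRank (Y : Set α)
    rw [hs] at h
    have h' := ENat.toNat_le_toNat h (by simp)
    simpa using h'
  · intro c' c hc'c hcs
    rw [hlevel c', hlevel c]
    exact level_profile_mono M₁ hs c' c hc'c hcs

/-- **C-025 AT EVERY `(p, q)` WITH `p ≤ r` AND `q ≤ s + m − r` ON `T_r(M₁ ⊕ U_{m,m})`, `M₁` ANY FINITE MATROID**: the rows
`(q, u)`, `q < u < p`, through the pointwise bridge. -/
theorem rls_of_split_matroid_all (hE : gr M = gr M₁ ∪ E₂) (hdisj : Disjoint (gr M₁) E₂)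
    {s : ℕ} (hs : M₁.eRank = (s : ℕ∞))
    (hrk : ∀ X : Finset α, X ⊆ gr M →
      M.eRk (X : Set α) = ((min r ((M₁.eRk ((X ∩ gr M₁ : Finset α) : Set α)).toNat + (X ∩ E₂).card) : ℕ) : ℕ∞))
    (p q : ℕ) (hpr : p ≤ r) (hreg : r + q ≤ s + E₂.card) :
    ThmN.RLS M p q := by
  apply GirthRows.rls_of_profileIneq_rows
  intro u hu1 hu2
  exact profileIneq_rows_of_split_matroid M M₁ E₂ r hE hdisj hs hrk q u hu1 (by omega) hreg

end Matroid

end OneFlat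

end PercRepro
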